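import Mathlib.Analysis.InnerProductSpace.Orthogonal
import Mathlib.LinearAlgebra.Dimension.Constructions
import Summits.NavierStokesRegularity.NavierStokesRegularity.Theorems.CertifiedBlowupProfileData
import HarnessLib

/-!
# The finite inequality package of a certified self-similar blow-up (route `CertifiedBlowup`)

Problem `NavierStokesRegularity`, route `CertifiedBlowup` (definition request
`Literature.NS.BlowupProfileConditions`, item `wi-03627`; companion of `BlowupProfileData`).

A computer-assisted blow-up proof in the style of Chen–Hou (arXiv:2210.07191 = Part I, §2.3 and
Appendix A, Lemma A.2; arXiv:2305.05660 = Part II, rigorous numerics) has the logical shape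

  *finite inequalities on certified constants* `⟹` *nonlinear stability of the approximate
  self-similar profile in the dynamic-rescaling formulation* `⟹` *finite-time blow-up*.

The first arrow is an abstract bootstrap ("stability lemma", Part I Lemma A.2 and (A.11)): if the
residual of the approximate steady state is `≤ ε` in the energy norm, the linearised operator is
`κ`-coercive on the complement of a finite-rank (modulated) subspace, the nonlinear/nonlocal
remainders obey estimates with explicit constants `cⱼ`, and a *closure inequality* between
`ε, κ, cⱼ` holds at some threshold `E*` (Part I (A.11): `aᵢᵢ E* − Σ (|aᵢⱼ| E* + |aᵢⱼ,₂| E*² + |aᵢⱼ,₃|)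
> ε₀`), then the perturbation energy stays below `E*` for all rescaled times. This file records
that package of inequalities as a `Prop`.

## Design (read this before the definitions)

* **What is and is not defined here.** The constants live in the finite rational datum
  `d : BlowupProfileData`. Conditions (iii) *closure* and (iv) *admissibility of the exponents* are
  genuine scalar inequalities on `d` and are defined outright (`ClosureAt`, `closureDiscriminant`,
  `ExponentsAdmissible`, all decidable over `ℚ`). Conditions (i) *residual bound* and (ii)
  *coercivity* (and the nonlinear estimates whose constants enter (iii)) are inequalities between
  `d`'s constants and **analytic objects** — the weighted energy space, the residual of `d`'s
  reconstructed profile under the rescaled Navier–Stokes operator with exponents `(d.cl, d.cw)`,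
  the energy production form of the linearised operator, the energy pairings of the nonlinear
  remainders. `BlowupProfileData` carries no semantics for its coefficient arrays (which basis,
  which components, which singular weights — in Chen–Hou the weights are themselves fitted data),
  so these objects cannot be reconstructed from `d` alone. They are therefore packaged as an
  explicit parameter `F : StabilityFrame d` (pure data: a real inner-product space `X`, a synthesis
  map `reconstruct` from coefficient arrays of `d`'s shape into `X`, `residual : X`,
  `linForm : X → ℝ`, `nonlinForms : List (X → ℝ)`), and
  `BlowupProfileConditions d F : Prop` is the conjunction (i)–(iv) *relative to* `F`.
  The **canonical frame** `F = nsFrame d` (axisymmetric Navier–Stokes in similarity variables,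
  Chebyshev reconstruction, Chen–Hou weights) is NOT constructed here; it is the natural next
  definition item of the route, and the route's analytic crux then reads
  `∀ d, d.IsWellFormed → BlowupProfileConditions d (nsFrame d) → <blow-up>`. The abstract
  bootstrap `BlowupProfileConditions d F → <energy stays below E*>` is frame-independent and
  provable now (it is Lemma A.2 in energy form).
* **Energy form, not `L∞` form.** The request asks for `κ`-coercivity "in the weighted energy
  inner product on the complement of `d`'s finite-rank space", i.e. the weighted-`L²`/`H¹`
  framework of Chen–Hou 2021 (CMP 383) and Chen–Hou–Huang; Part I of Chen–Hou 2022 uses weighted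
  `L∞ ∩ C^{1/2}` energies instead (Lemma A.2 is stated along characteristics). The package below is
  the energy-form analogue: with `E = ‖v‖`, the energy identity
  `½ d/dτ E² = linForm v + Σⱼ Nⱼ v + ⟪residual, v⟫` and (i)–(iii) give
  `½ d/dτ E² ≤ −κ E² + (Σ cⱼ) E³ + ε E`, which is `< 0` at `E = E*` exactly when
  `ε + (Σ cⱼ) E*² < κ E*` (`ClosureAt`), the shape of (A.11).
* **The finite-rank space.** `F.unstable := span (reconstruct ∘ d.unstableBasis)`, so it is tied
  to `d`'s rational basis and has `finrank ≤ d.unstableRank` (`finrank_unstable_le`, proved);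
  coercivity is required on its orthogonal complement `F.unstableᗮ` in `X`.
* **Exponent convention (iv).** Chen–Hou Part I (2.6)–(2.9): `ω̃(x, τ) = C_ω(τ) ω(C_l(τ) x, t(τ))`,
  `C_ω = exp ∫₀^τ c_ω`, `C_l = exp ∫₀^τ (−c_l)`, `dt/dτ = C_ω`. Then `‖ω(t)‖ ~ C_ω⁻¹` blows up in
  finite original time `T = ∫₀^∞ C_ω dτ` iff `c_ω < 0`, and the viscous term `ν Δω` becomes
  `ν C_ω C_l⁻² Δω̃ = ν exp(∫₀^τ (c_ω + 2 c_l)) Δω̃` in the rescaled equation, so it stays bounded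
  ("controlled under the chosen scaling") iff `c_ω + 2 c_l ≤ 0` (equality = exactly self-similar
  Navier–Stokes scaling `x ~ (T−t)^{1/2}`, `ω ~ (T−t)⁻¹`, i.e. `c_l = ½ |c_ω|`). Chen–Hou's Euler
  profile has `c̄_l ≈ 3.006`, `c̄_ω ≈ −1.029` (Part I (2.23)), hence `c̄_ω + 2 c̄_l > 0`: it is *not*
  NS-admissible, as expected (`BlowupProfileData.toy`, with `(c_l, c_ω) = (3, −1)`, fails (iv):
  `not_exponentsAdmissible_toy`).
* Constants of `d` are rational and are cast to `ℝ` in (i)–(iii); the `j`-th entry of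
  `d.nonlinearConsts` bounds the `j`-th entry of `F.nonlinForms` (`List.Forall₂`, so the lengths
  must agree), and their sum enters the closure inequality.

## References

* J. Chen, T. Y. Hou, *Stable nearly self-similar blowup of the 2D Boussinesq and 3D Euler
  equations with smooth data I: Analysis*, arXiv:2210.07191, §2.1 (2.6)–(2.11) (dynamic
  rescaling), §2.3 (main steps: small residual, linear stability modulo finite rank, nonlinear
  stability via the stability lemma), Appendix A, Lemma A.2 and (A.9)–(A.11) (the bootstrap and its
  closure inequality). [ChenHou2022]
* J. Chen, T. Y. Hou, *… II: Rigorous numerics*, arXiv:2305.05660 (the constants are verified with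
  interval arithmetic). [ChenHou2023]
* T. Y. Hou, *The potentially singular behavior of the 3D Navier–Stokes equations*,
  arXiv:2107.06509, §3.4 (nearly self-similar scaling `R(t), Z(t) ~ (T−t)^{1/2}` compatible with
  the viscous term).
-/

noncomputable section

open scoped RealInnerProductSpace

namespace Literature.NS

/-! ### Scalar conditions on the datum: closure (iii) and exponents (iv) -/

namespace BlowupProfileData

/-- The aggregate nonlinear constant `C = Σⱼ cⱼ` of the datum (sum of `nonlinearConsts`).
[cite: ChenHou2022, App. A (A.10)–(A.11)] -/
def nonlinConst (d : BlowupProfileData) : ℚ :=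
  d.nonlinearConsts.sum

/-- **Closure inequality at threshold `E*`** (condition (iii), the shape of Chen–Hou Part I
(A.11) `aᵢᵢ E* − (… E*² + …) > ε₀ > 0` in energy form): `0 < E*` and
`ε + C E*² < κ E*` with `ε = d.residualBound`, `κ = d.coercivity`, `C = d.nonlinConst`. At such an
`E*` the a-priori inequality `½ (E²)' ≤ −κ E² + C E³ + ε E` is strictly negative, which closes the
bootstrap `E(τ) < E*`. [cite: ChenHou2022, App. A, Lemma A.2, (A.11)] -/
def ClosureAt (d : BlowupProfileData) (Estar : ℝ) : Prop :=
  0 < Estar ∧ (d.residualBound : ℝ) + (d.nonlinConst : ℝ) * Estar ^ 2 < (d.coercivity : ℝ) * Estar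

/-- The **closure discriminant** (a decidable rational test implying `∃ E*, d.ClosureAt E*`, see
`exists_closureAt`): `0 < κ`, `0 ≤ C` and `4 ε C < κ²`. [folklore] -/
def closureDiscriminant (d : BlowupProfileData) : Prop :=
  0 < d.coercivity ∧ 0 ≤ d.nonlinConst ∧ 4 * d.residualBound * d.nonlinConst < d.coercivity ^ 2

/-- The closure discriminant is decidable (rational comparisons; concrete data by
`norm_num [closureDiscriminant, nonlinConst]`). [folklore] -/
instance (d : BlowupProfileData) : Decidable d.closureDiscriminant := by
  unfold closureDiscriminant; infer_instance

/-- **Admissibility of the dynamic-rescaling exponents for Navier–Stokes** (condition (iv)), in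
the convention of Chen–Hou Part I (2.6)–(2.9) (`C_ω = exp ∫ c_ω`, `C_l = exp ∫ (−c_l)`,
`dt/dτ = C_ω`): `c_ω < 0` (the amplitude `C_ω⁻¹` blows up at the finite original time
`T = ∫₀^∞ C_ω dτ`) and `c_ω + 2 c_l ≤ 0` (the rescaled viscosity `ν C_ω C_l⁻²` is non-increasing,
so the viscous term is controlled; equality is the exactly self-similar Navier–Stokes scaling).
[cite: ChenHou2022, §2.1 (2.6)–(2.9)] -/
def ExponentsAdmissible (d : BlowupProfileData) : Prop :=
  d.cw < 0 ∧ d.cw + 2 * d.cl ≤ 0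

/-- Admissibility of the exponents is decidable (rational comparisons; concrete data by
`norm_num [ExponentsAdmissible]`). [folklore] -/
instance (d : BlowupProfileData) : Decidable d.ExponentsAdmissible := by
  unfold ExponentsAdmissible; infer_instance

/-- The closure discriminant produces a threshold: if `0 < κ`, `0 ≤ C`, `4 ε C < κ²` then
`d.ClosureAt E*` for `E* = κ / (2C)` (`C > 0`) resp. `E* = (|ε| + 1) / κ` (`C = 0`). [folklore] -/
theorem exists_closureAt (d : BlowupProfileData) (h : d.closureDiscriminant) :
    ∃ Estar : ℝ, d.ClosureAt Estar := by
  obtain ⟨hκ, hC, hdisc⟩ := h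
  have hκ' : (0 : ℝ) < d.coercivity := by exact_mod_cast hκ
  have hC' : (0 : ℝ) ≤ d.nonlinConst := by exact_mod_cast hC
  have hdisc' : (4 : ℝ) * d.residualBound * d.nonlinConst < (d.coercivity : ℝ) ^ 2 := by
    exact_mod_cast hdisc
  rcases hC'.eq_or_lt with hC0 | hCpos
  · -- `C = 0`: take `E* = (|ε| + 1) / κ`
    refine ⟨(|(d.residualBound : ℝ)| + 1) / d.coercivity, ?_, ?_⟩
    · positivity
    · rw [← hC0, zero_mul, add_zero, mul_div_cancel₀ _ hκ'.ne']
      exact (le_abs_self _).trans_lt (lt_add_one _)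
  · -- `C > 0`: take `E* = κ / (2C)`
    refine ⟨(d.coercivity : ℝ) / (2 * d.nonlinConst), by positivity, ?_⟩
    have h2C : (0 : ℝ) < 2 * d.nonlinConst := by positivity
    rw [← sub_pos]
    have key : (d.coercivity : ℝ) * (d.coercivity / (2 * d.nonlinConst)) -
        ((d.residualBound : ℝ) + d.nonlinConst * (d.coercivity / (2 * d.nonlinConst)) ^ 2) =
        ((d.coercivity : ℝ) ^ 2 - 4 * d.residualBound * d.nonlinConst) / (4 * d.nonlinConst) := by
      field_simp
      ring
    rw [key]
    exact div_pos (sub_pos.2 hdisc') (by positivity)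

/-- Chen–Hou's Euler exponents `(c_l, c_ω) ≈ (3, −1)` (carried by `BlowupProfileData.toy`) are not
Navier–Stokes admissible: `c_ω + 2 c_l = 5 > 0` (the rescaled viscosity grows). [folklore] -/
theorem not_exponentsAdmissible_toy : ¬ toy.ExponentsAdmissible := by
  norm_num [ExponentsAdmissible, toy]

end BlowupProfileData

/-! ### The analytic frame and the full package (i)–(iv) -/

/-- **Analytic frame of a certified blow-up argument for the datum `d`** (pure data, no `Prop`
fields): the objects to which the rational constants of `d` refer in a Chen–Hou-type nonlinear
stability proof in *energy form* —

* `X`, a real inner-product space (the weighted energy space of perturbations `v` of the profile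
  in the dynamic-rescaling variables);
* `reconstruct`, the synthesis map sending a coefficient array of `d`'s shape
  (`Fin d.numComponents → Fin d.degR → Fin d.degZ → ℚ`) to the element of `X` it represents
  (tensor-product Chebyshev/spline reconstruction); it interprets `d.unstableBasis`;
* `residual`, the residual `F̄` of `d`'s reconstructed profile under the rescaled operator with
  exponents `(d.cl, d.cw)`, as an element of `X` (Chen–Hou Part I, Lemma 2.1 and (2.19));
* `linForm v = ⟪L v, v⟫_X`, the energy production of the linearised operator `L` about the profile
  (Part I §2.3, Lemma 2.2: linear stability);
* `nonlinForms`, the energy pairings `v ↦ ⟪Nⱼ(v), v⟫_X` of the finitely many nonlinear and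
  nonlocal remainder terms (Part I (2.18), (A.9)–(A.10)), listed in the order of
  `d.nonlinearConsts`.

The frame is a parameter of `BlowupProfileConditions`; the canonical Navier–Stokes frame is a
separate construction (see the module docstring). [cite: ChenHou2022, §2.3 and App. A (A.9)–(A.10)] -/
structure StabilityFrame (d : BlowupProfileData) where
  /-- The weighted energy space. -/
  X : Type
  /-- `X` is a normed group. -/
  [instNormedAddCommGroup : NormedAddCommGroup X]
  /-- `X` is a real inner-product space. -/
  [instInnerProductSpace : InnerProductSpace ℝ X]
  /-- Synthesis of coefficient arrays of `d`'s shape into `X`. -/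
  reconstruct : (Fin d.numComponents → Fin d.degR → Fin d.degZ → ℚ) → X
  /-- Residual of `d`'s profile under the rescaled operator with exponents `(d.cl, d.cw)`. -/
  residual : X
  /-- Energy production `v ↦ ⟪L v, v⟫` of the linearised operator about the profile. -/
  linForm : X → ℝ
  /-- Energy pairings `v ↦ ⟪Nⱼ v, v⟫` of the nonlinear/nonlocal remainder terms. -/
  nonlinForms : List (X → ℝ)

namespace StabilityFrame

attribute [instance] instNormedAddCommGroup instInnerProductSpace

variable {d : BlowupProfileData}

/-- The finite-rank **unstable/neutral subspace** of the frame: the span in `X` of the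
reconstructions of `d`'s rational basis arrays `d.unstableBasis`. [cite: ChenHou2022, §1 and §2.3 (finite rank part)] -/
def unstable (F : StabilityFrame d) : Submodule ℝ F.X :=
  Submodule.span ℝ (Set.range (F.reconstruct ∘ d.unstableBasis))

/-- The unstable subspace has rank at most `d.unstableRank`. [folklore] -/
theorem finrank_unstable_le (F : StabilityFrame d) :
    Module.finrank ℝ F.unstable ≤ d.unstableRank := by
  have h := finrank_range_le_card (R := ℝ) (F.reconstruct ∘ d.unstableBasis)
  rw [Fintype.card_fin] at h
  exact h

/-- The total nonlinear energy pairing `v ↦ Σⱼ ⟪Nⱼ v, v⟫`. [folklore] -/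
def totalNonlin (F : StabilityFrame d) (v : F.X) : ℝ :=
  (F.nonlinForms.map fun N => N v).sum

end StabilityFrame

/-- **The finite inequality package a certified blow-up proof consumes** (route `CertifiedBlowup`),
for the datum `d` relative to the analytic frame `F` (energy form of Chen–Hou Part I §2.3 and
Lemma A.2; write `ε = d.residualBound`, `κ = d.coercivity`, `cⱼ = d.nonlinearConsts[j]`,
`C = Σ cⱼ`, all cast to `ℝ`):

* (i) `residual_le`: the residual of `d`'s profile under the rescaled operator has energy norm
  `‖F̄‖ ≤ ε` (Part I, Lemma 2.1: "residual errors sufficiently small in some energy norm");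
* (ii) `coercive`: the linearised operator is `κ`-coercive in the energy inner product on the
  orthogonal complement of the finite-rank space spanned by `d`'s unstable basis:
  `⟪L v, v⟫ ≤ −κ ‖v‖²` for `v ∈ F.unstableᗮ` (Part I §2.3, Lemma 2.2, `L = L₀ + K` with `K` of
  finite rank);
* (iii) `nonlin_le` and `closure`: the `j`-th nonlinear/nonlocal pairing is bounded by
  `cⱼ ‖v‖³` (Part I (A.10), the `aᵢⱼ,₂ E²` terms), and the closure inequality
  `ε + C E*² < κ E*` holds at some threshold `E* > 0` (Part I (A.11));
* (iv) `exponents`: `d.ExponentsAdmissible` (`c_ω < 0`, `c_ω + 2 c_l ≤ 0`: finite blow-up time and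
  controlled viscous term in the convention of Part I (2.6)–(2.9)).

With the canonical Navier–Stokes frame in place of `F` this is the hypothesis of the route's
analytic theorem; the abstract bootstrap it feeds is frame-independent. [cite: ChenHou2022, §2.3, Lemmas 2.1–2.4 and App. A, Lemma A.2, (A.9)–(A.11)] -/
structure BlowupProfileConditions (d : BlowupProfileData) (F : StabilityFrame d) : Prop where
  /-- (i) residual bound `‖F̄‖ ≤ ε`. -/
  residual_le : ‖F.residual‖ ≤ (d.residualBound : ℝ)
  /-- (ii) `κ`-coercivity of the linearised energy form on the complement of the unstable space. -/
  coercive : ∀ v ∈ F.unstableᗮ, F.linForm v ≤ -(d.coercivity : ℝ) * ‖v‖ ^ 2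
  /-- (iii-a) nonlinear/nonlocal estimates with the explicit constants of `d` (same order and
  number as `d.nonlinearConsts`). -/
  nonlin_le : List.Forall₂ (fun (N : F.X → ℝ) (c : ℚ) => ∀ v : F.X, |N v| ≤ (c : ℝ) * ‖v‖ ^ 3)
    F.nonlinForms d.nonlinearConsts
  /-- (iii-b) closure inequality at some threshold `E* > 0`: `ε + C E*² < κ E*`. -/
  closure : ∃ Estar : ℝ, d.ClosureAt Estar
  /-- (iv) admissibility of the exponents `(c_l, c_ω)`. -/
  exponents : d.ExponentsAdmissible

namespace BlowupProfileConditions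

variable {d : BlowupProfileData} {F : StabilityFrame d}

/-- Under (iii-a) the total nonlinear pairing is bounded by `C ‖v‖³`, `C = Σ cⱼ = d.nonlinConst`.
[cite: ChenHou2022, App. A (A.10)] -/
theorem abs_totalNonlin_le (h : BlowupProfileConditions d F) (v : F.X) :
    |F.totalNonlin v| ≤ (d.nonlinConst : ℝ) * ‖v‖ ^ 3 := by
  unfold StabilityFrame.totalNonlin BlowupProfileData.nonlinConst
  have key : ∀ (Ns : List (F.X → ℝ)) (cs : List ℚ),
      List.Forall₂ (fun (N : F.X → ℝ) (c : ℚ) => ∀ v : F.X, |N v| ≤ (c : ℝ) * ‖v‖ ^ 3) Ns cs →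
      |(Ns.map fun N => N v).sum| ≤ ((cs.sum : ℚ) : ℝ) * ‖v‖ ^ 3 := by
    intro Ns cs hN
    induction hN with
    | nil => simp
    | @cons N c Ns cs hNc _ ih =>
      simp only [List.map_cons, List.sum_cons, Rat.cast_add, add_mul]
      exact (abs_add_le _ _).trans (add_le_add (hNc v) ih)
  exact key _ _ h.nonlin_le

/-- **The a-priori energy inequality closes at the threshold.** Under the package, for
`v ∈ F.unstableᗮ` with `‖v‖ = E*` the right-hand side of the energy identity
`½ (‖v‖²)' = ⟪L v, v⟫ + Σⱼ ⟪Nⱼ v, v⟫ + ⟪F̄, v⟫` is strictly negative — the inequality that drives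
the bootstrap of Chen–Hou Part I, Lemma A.2. [cite: ChenHou2022, App. A, Lemma A.2] -/
theorem energyRHS_neg (h : BlowupProfileConditions d F) :
    ∃ Estar : ℝ, 0 < Estar ∧ ∀ v ∈ F.unstableᗮ, ‖v‖ = Estar →
      F.linForm v + F.totalNonlin v + ⟪F.residual, v⟫ < 0 := by
  obtain ⟨Estar, hE, hclose⟩ := h.closure
  refine ⟨Estar, hE, fun v hv hnorm => ?_⟩
  have h1 := h.coercive v hv
  have h2 := (le_abs_self _).trans (h.abs_totalNonlin_le v)
  have h3 : ⟪F.residual, v⟫ ≤ (d.residualBound : ℝ) * Estar :=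
    (real_inner_le_norm _ _).trans (by rw [hnorm]; exact mul_le_mul_of_nonneg_right h.residual_le hE.le)
  rw [hnorm] at h1 h2
  nlinarith [h1, h2, h3, hclose, hE]

end BlowupProfileConditions

end Literature.NS

end
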